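import Summits.KontsevichZagierPeriods.KontsevichZagierPeriods.Theorems.KzOnePeriodsE1XiDeriv
import Summits.KontsevichZagierPeriods.KontsevichZagierPeriods.Theorems.KzOnePeriodsG0DerivLogSegment

/-!
# KontsevichZagierPeriods — kz1p third kind on the pole chart, part 3: `ξ_P + ξ_{−P}` and the real logarithm

Cell pub-kz1p, seat b2b-kz1p-2, gen 22 (kz1p v2.6, shape (Ξ′); PROCEDURE.md §4j; LEAN-IN-TREE rule).  Pure
mathematics over the tree's formal period space `Literature.NumberTheory.Transcendental.CurvePeriods`
(symbols `(Z, ω, γ)`, elementary relations (R1)–(R5) `IsElementaryRelation`, their soundness; the target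
theorem of Huber–Wüstholz [cite: HuberWustholz2022, Thm 13.3 (2) (p. 121)]: every `ℚ̄`-linear relation
among periods of curves is a `ℚ̄`-combination of (R1)–(R5), [cite: HuberWustholz2022, §13.1 (p. 120)]).
No named facts, no `sorry`; notations are local.

Part 1 (`KzOnePeriodsE1XiChart`) builds the pole chart `E^w_{A,B}(x₀) = {y² = x³ + Ax + B, (x − x₀)w = 1}`,
part 2 (`KzOnePeriodsE1XiDeriv`) the third-kind form `ξ_P = (y + y₀)·w·pr^*θ₀` (`P = (x₀, y₀)`; kz1p:
`ξ_P = (y + y_P)/(x − x_P) · dx/y`) and the rule `IMG` ((R4) along `[i]^w`).  This part supplies the two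
moves behind kz1p's second third-kind rule `IMG2` (`ξ_{[i]A}(g) + ξ_A([i]g) = 2·[log(x − x_A)]_{[i]g}`,
certificate rows `IMG2-A-g1-Ai-g2` of tests E1-21/E1-22):

* `vanishesOn_xi_sum`, `xi_sum_derivation` — **`ξ_P + ξ_{−P} = 2·w dx` in `Ω¹(E^w(x₀))`**: on tangent
  vectors `y·θ₀ = dx` [cite: HuberWustholz2022, §9.2 (p. 87)] (`Weier.z_one_mul_theta0_apply`), so
  `(y + y₀)w·θ₀ + (y − y₀)w·θ₀ = 2yw·θ₀ = 2w dx`; hence `(ξ_P, γ) + (ξ_{−P}, γ) − 2·(w dx, γ) ∈ ⟨(R1), (R2)⟩_ℚ̄`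
  and `∫_γ ξ_P + ∫_γ ξ_{−P} = 2 ∫_γ w dx` for EVERY path `γ` on the chart;
* `formPullback_psi`, `wdx_derivation` — along `ψ = (x − x₀, w) : E^w(x₀) → 𝔾ₘ = {uv = 1}` one has
  `ψ^*(v du) = w dx` exactly, so `(E^w, w dx, γ) ∼ (𝔾ₘ, v du, ψ∘γ)` ((R4) [cite: HuberWustholz2022, §13.1 (B)
  (p. 120)]) — `∫_γ w dx = ∫_γ dx/(x − x₀)` is a logarithm on `𝔾ₘ`;
* `exists_log_realPos`, `span_realPos_logSym` — **the principal real logarithm**: if the first coordinate of a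
  path `δ` on `𝔾ₘ` is real and positive on `[0, 1]`, from `p` to `q = w·p`, then `(𝔾ₘ, v du, δ) ∼ ℓ(log w)`, the
  standard logarithm symbol of the kz1p G0 files (`ℓ(M) = (𝔾ₘ, v du, (e^{tM}, e^{−tM}))`, period `M`,
  `period_realLogPath`) with the REAL logarithm `log w = log q − log p` ((R5) to the exponential path with the
  same `C¹` logarithm, `single_path_eq_single_expPath` [cite: HuberWustholz2022, §3.3.1 (pp. 42–43)], then the
  (R4) base change `rel_expPath_baseChange`; the increment of the `C¹` logarithm is pinned by comparing
  derivatives with `t ↦ log Re δ₀(t)` on `[0, 1]`).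

Part 4 (`KzOnePeriodsE1XiImg2`) assembles these with part 2's `[i]^w`-functoriality into the `IMG2` derivation.
-/

noncomputable section

open scoped BigOperators
open MvPolynomial Set Complex Filter Topology
open Literature.NumberTheory.Transcendental Literature.NumberTheory.Transcendental.CurvePeriods
open Summit.KontsevichZagierPeriods.KzOnePeriods.E1Derivation
open Summit.KontsevichZagierPeriods.KzOnePeriods.G2SDerivation

namespace Summit.KontsevichZagierPeriods.KzOnePeriods.XiDerivation

local notation3 "InSpanRel " c:arg => ∃ (k : ℕ) (ρ : Fin k → (PeriodSymbol →₀ ℂ))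
  (a : Fin k → ℂ), (∀ l, IsElementaryRelation (ρ l)) ∧ (∀ l, IsAlgebraic ℚ (a l)) ∧
    c = ∑ l, a l • ρ l

/-- The symbol `(Z, ω, γ)` as an element of the formal period space. -/
local notation3 (prettyPrint := false) "Sy[" Z ", " hZ ", " ω ", " h ", " γ "]" =>
  (Finsupp.single (⟨Z, hZ, ω, h, γ⟩ : PeriodSymbol) (1 : ℂ) : PeriodSymbol →₀ ℂ)

/-- The period `∫_γ ω` of the symbol `(Z, ω, γ)`. -/
local notation3 (prettyPrint := false) "Pe[" Z ", " hZ ", " ω ", " h ", " γ "]" =>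
  PeriodSymbol.period (⟨Z, hZ, ω, h, γ⟩ : PeriodSymbol)

/-- The cubic `x³ + Ax + B ∈ ℂ[x, y, w]`. -/
local notation3 (prettyPrint := false) "fW[" A ", " B "]" =>
  ((X 0 : MvPolynomial (Fin 3) ℂ) ^ 3 + C A * X 0 + C B)

/-- The pole chart `E^w_{A,B}(x₀) = {y² = x³ + Ax + B, (x − x₀)·w = 1} ⊂ 𝔸³`. -/
local notation3 (prettyPrint := false) "EW[" A ", " B ", " x₀ "]" =>
  (⟨3, 2, ![(X 1 : MvPolynomial (Fin 3) ℂ) ^ 2 - fW[A, B], (X 0 - C x₀) * X 2 - 1]⟩ : CurveData)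

/-- The projection `pr = (x, y) : E^w → E`. -/
local notation3 (prettyPrint := false) "proj" => (![X 0, X 1] : Fin 2 → MvPolynomial (Fin 3) ℂ)

/-- **The third-kind form** `ξ_P = (y + y₀)·w · pr^*θ₀` on `E^w_{A,B}(x₀)`, `P = (x₀, y₀)`. -/
local notation3 (prettyPrint := false) "ξ[" A ", " B ", " y₀ "]" =>
  ((((X 1 : MvPolynomial (Fin 3) ℂ) + C y₀) * X 2) • formPullback proj (Weier.theta0 A B))

/-- The form `w dx` on `E^w_{A,B}(x₀)` (`= dx/(x − x₀)` on the chart). -/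
local notation3 (prettyPrint := false) "wdx" => (![X 2, 0, 0] : Fin 3 → MvPolynomial (Fin 3) ℂ)

/-- `ψ = (x − x₀, w) : E^w_{A,B}(x₀) → 𝔾ₘ`. -/
local notation3 (prettyPrint := false) "ψ[" x₀ "]" =>
  (![X 0 - C x₀, X 2] : Fin 2 → MvPolynomial (Fin 3) ℂ)

/-- The multiplicative group `𝔾ₘ = {uv = 1} ⊂ 𝔸²`. -/
local notation3 (prettyPrint := false) "𝔾m" => (⟨2, 1, ![X 0 * X 1 - 1]⟩ : CurveData)

/-- The logarithm symbol `(𝔾ₘ, v du, E)` over a path `E` on `𝔾ₘ`. -/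
local notation3 "logSym " E:arg => (⟨⟨2, 1, ![X 0 * X 1 - 1]⟩, isSmoothAffineCurve_mulGroup,
  ![X 1, 0], hasAlgCoeffs_ydx, E⟩ : PeriodSymbol)

variable {A B x₀ : ℂ}

/-! ### `ξ_P + ξ_{−P} = 2·w dx` in `Ω¹(E^w(x₀))` -/

/-- `w dx` is defined over `ℚ̄`. -/
theorem hasAlgCoeffs_wdx : ∀ i, HasAlgCoeffs ((wdx) i) := fun i => by
  fin_cases i
  · simpa using hasAlgCoeffs_X (n := 3) 2
  · simpa using (hasAlgCoeffs_zero (n := 3))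
  · simpa using (hasAlgCoeffs_zero (n := 3))

/-- `2·w dx` is defined over `ℚ̄`. -/
theorem hasAlgCoeffs_two_wdx : ∀ i, HasAlgCoeffs (((2 : ℂ) • wdx) i) := fun i => by
  rw [Pi.smul_apply]
  exact HasAlgCoeffs.smul Ell.isAlgebraic_two (hasAlgCoeffs_wdx i)

/-- **`ξ_P + ξ_{−P} − 2·w dx` vanishes on `E^w_{A,B}(x₀)`** (`4A³ + 27B² ≠ 0`, `y₀ + y₀′ = 0`): at `z ∈ E^w`
and `v` tangent, `ξ_{(x₀, y)}(z)(v) = (z₁ + y)·z₂·θ₀(z)(v)` and `z₁·θ₀(z)(v) = v₀` (`y·θ₀ = dx`), so the sum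
pairs to `2 z₁ z₂ θ₀(v) − 2 z₂ v₀ = 0`. -/
theorem vanishesOn_xi_sum (hD : Weier.disc A B ≠ 0) {y₀ y₀' : ℂ} (hy : y₀ + y₀' = 0) :
    VanishesOn EW[A, B, x₀] (ξ[A, B, y₀] + ξ[A, B, y₀'] - (2 : ℂ) • wdx) := by
  intro z hz v hv
  obtain ⟨hz1, -⟩ := (mem_pointsEW_iff z).1 hz
  obtain ⟨hv1, -⟩ := (mem_tangentSpaceEW_iff z v).1 hv
  have hp : (![z 0, z 1] : Fin 2 → ℂ) ∈ (weierCurve A B).points :=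
    (Weier.mem_points_iff A B _).2 (by rw [Weier.eval_fPoly]; simpa using hz1)
  have hpv : (![v 0, v 1] : Fin 2 → ℂ) ∈ (weierCurve A B).tangentSpace ![z 0, z 1] := by
    rw [Weier.mem_tangentSpace_iff, Weier.eval_pderiv_zero_fPoly]
    simpa using hv1
  have hθ := Weier.z_one_mul_theta0_apply A B hp hpv hD
  simp only [Fin.sum_univ_two, Matrix.cons_val_zero, Matrix.cons_val_one] at hθ
  have hξ : ∀ y : ℂ, ∑ i, eval z (ξ[A, B, y] i) * v i = (z 1 + y) * z 2 *
      (eval ![z 0, z 1] (Weier.theta0 A B 0) * v 0 + eval ![z 0, z 1] (Weier.theta0 A B 1) * v 1) := by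
    intro y
    rw [← proj_pair (Weier.theta0 A B) z v, Finset.mul_sum]
    refine Finset.sum_congr rfl fun i _ => ?_
    simp only [Pi.smul_apply, smul_eq_mul, map_mul, map_add, eval_X, eval_C]
    ring
  have hw : ∑ i, eval z ((wdx) i) * v i = z 2 * v 0 := by
    simp [Fin.sum_univ_three]
  have e : ∀ i, eval z ((ξ[A, B, y₀] + ξ[A, B, y₀'] - (2 : ℂ) • wdx) i) * v i =
      eval z (ξ[A, B, y₀] i) * v i + eval z (ξ[A, B, y₀'] i) * v i -
        2 * (eval z ((wdx) i) * v i) := by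
    intro i
    simp only [Pi.sub_apply, Pi.add_apply, Pi.smul_apply, smul_eq_C_mul, map_sub, map_add, map_mul,
      eval_C]
    ring
  rw [Finset.sum_congr rfl fun i _ => e i, Finset.sum_sub_distrib, Finset.sum_add_distrib,
    ← Finset.mul_sum, hξ, hξ, hw]
  linear_combination (2 * z 2) * hθ +
    (z 2 * (eval ![z 0, z 1] (Weier.theta0 A B 0) * v 0 +
      eval ![z 0, z 1] (Weier.theta0 A B 1) * v 1)) * hy

/-- **`ξ_P + ξ_{−P} ∼ 2·w dx`.**  For every path `γ` on `E^w_{A,B}(x₀)` (`4A³ + 27B² ≠ 0`, `y₀ + y₀′ = 0`):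
`(E^w, ξ_{(x₀,y₀)}, γ) + (E^w, ξ_{(x₀,y₀′)}, γ) − 2·(E^w, w dx, γ) ∈ ⟨(R1)–(R5)⟩_ℚ̄` ((R1) linearity,
(R2) for `ξ_P + ξ_{−P} − 2 w dx = 0` in `Ω¹(E^w)`; [cite: HuberWustholz2022, §13.1 (A) (p. 120)]) and
`∫_γ ξ_P + ∫_γ ξ_{−P} = 2 ∫_γ w dx` (soundness, `evalCombination_eq_zero_of_isElementaryRelation`). -/
theorem xi_sum_derivation (hE : EW[A, B, x₀].IsSmoothAffineCurve) (hD : Weier.disc A B ≠ 0)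
    {y₀ y₀' : ℂ} (hy : y₀ + y₀' = 0) (hξ : ∀ i, HasAlgCoeffs (ξ[A, B, y₀] i))
    (hξ' : ∀ i, HasAlgCoeffs (ξ[A, B, y₀'] i)) (γ : CurvePath EW[A, B, x₀]) :
    InSpanRel (Sy[EW[A, B, x₀], hE, ξ[A, B, y₀], hξ, γ] + Sy[EW[A, B, x₀], hE, ξ[A, B, y₀'], hξ', γ] -
        (2 : ℂ) • Sy[EW[A, B, x₀], hE, wdx, hasAlgCoeffs_wdx, γ]) ∧
      Pe[EW[A, B, x₀], hE, ξ[A, B, y₀], hξ, γ] + Pe[EW[A, B, x₀], hE, ξ[A, B, y₀'], hξ', γ] =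
        2 * Pe[EW[A, B, x₀], hE, wdx, hasAlgCoeffs_wdx, γ] := by
  have hs : ∀ i, HasAlgCoeffs ((ξ[A, B, y₀] + ξ[A, B, y₀']) i) := fun i => (hξ i).add (hξ' i)
  have hν : ∀ i, HasAlgCoeffs ((ξ[A, B, y₀] + ξ[A, B, y₀'] - (2 : ℂ) • wdx) i) :=
    fun i => (hs i).sub (hasAlgCoeffs_two_wdx i)
  -- (R1a): `(ξ_P + ξ_{−P}) − ξ_P − ξ_{−P}`
  have rA := IsElementaryRelation.add EW[A, B, x₀] hE γ (ξ[A, B, y₀] + ξ[A, B, y₀']) ξ[A, B, y₀]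
    ξ[A, B, y₀'] hs hξ hξ' rfl
  -- (R1a): `(ξ_P + ξ_{−P}) − ν − 2 w dx`, `ν = ξ_P + ξ_{−P} − 2 w dx`
  have rB := IsElementaryRelation.add EW[A, B, x₀] hE γ (ξ[A, B, y₀] + ξ[A, B, y₀'])
    (ξ[A, B, y₀] + ξ[A, B, y₀'] - (2 : ℂ) • wdx) ((2 : ℂ) • wdx) hs hν hasAlgCoeffs_two_wdx
    (sub_add_cancel _ _).symm
  -- (R1b): `(2 w dx) − 2·(w dx)`
  have rC := IsElementaryRelation.smul EW[A, B, x₀] hE γ 2 Ell.isAlgebraic_two wdx ((2 : ℂ) • wdx)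
    hasAlgCoeffs_wdx hasAlgCoeffs_two_wdx rfl
  -- (R2): `ν` vanishes on the curve
  have rD := IsElementaryRelation.vanish EW[A, B, x₀] hE γ _ hν (vanishesOn_xi_sum hD hy)
  obtain ⟨k, ρ, a, hρ, ha, hsum⟩ := span_add (span_add (span_sub (span_of_rel rB) (span_of_rel rA))
    (span_of_rel rD)) (span_of_rel rC)
  have hspan : InSpanRel (Sy[EW[A, B, x₀], hE, ξ[A, B, y₀], hξ, γ] +
      Sy[EW[A, B, x₀], hE, ξ[A, B, y₀'], hξ', γ] -
        (2 : ℂ) • Sy[EW[A, B, x₀], hE, wdx, hasAlgCoeffs_wdx, γ]) := by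
    refine ⟨k, ρ, a, hρ, ha, ?_⟩
    rw [← hsum]
    abel
  refine ⟨hspan, ?_⟩
  obtain ⟨k, ρ, a, hρ, ha, hc⟩ := hspan
  have h0 := evalCombination_eq_zero_of_isElementaryRelation ρ a hρ
  rw [← hc, sub_eq_add_neg, ← neg_smul, evalCombination_add, evalCombination_add,
    evalCombination_smul, evalCombination_single, evalCombination_single, evalCombination_single] at h0
  linear_combination h0

/-- The periods of two symbols whose difference is in `⟨(R1)–(R5)⟩_ℚ̄` are equal (soundness of
(R1)–(R5), [cite: HuberWustholz2022, §13.1 (p. 120)]). -/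
theorem period_eq_of_span {s s' : PeriodSymbol}
    (h : InSpanRel (Finsupp.single s (1 : ℂ) - Finsupp.single s' 1)) : s.period = s'.period := by
  obtain ⟨k, ρ, a, hρ, ha, hc⟩ := h
  have h0 := evalCombination_eq_zero_of_isElementaryRelation ρ a hρ
  rw [← hc, sub_eq_add_neg, ← neg_one_smul ℂ (Finsupp.single s' (1 : ℂ)), evalCombination_add,
    evalCombination_smul, evalCombination_single, evalCombination_single] at h0
  linear_combination h0

/-! ### `w dx = ψ^*(v du)` along `ψ = (x − x₀, w) : E^w(x₀) → 𝔾ₘ` -/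

/-- `ψ` is defined over `ℚ̄` for `x₀ ∈ ℚ̄`. -/
theorem hasAlgCoeffs_psi (hx₀ : IsAlgebraic ℚ x₀) : ∀ j, HasAlgCoeffs ((ψ[x₀]) j) := fun j => by
  fin_cases j
  · simpa using (hasAlgCoeffs_X (n := 3) 0).sub (hasAlgCoeffs_C hx₀)
  · simpa using hasAlgCoeffs_X (n := 3) 2

/-- `ψ(z) = (z₀ − x₀, z₂)`. -/
theorem eval_psi (x₀ : ℂ) (z : Fin 3 → ℂ) : (fun j => eval z ((ψ[x₀]) j)) = ![z 0 - x₀, z 2] := by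
  funext j
  fin_cases j <;> simp

/-- `ψ` maps `E^w_{A,B}(x₀)` into `𝔾ₘ`: `(z₀ − x₀) z₂ = 1`. -/
theorem psi_mem : ∀ z ∈ EW[A, B, x₀].points, (fun j => eval z ((ψ[x₀]) j)) ∈ (𝔾m).points := by
  intro z hz
  rw [eval_psi, mem_points_mulGroup_iff]
  simpa using ((mem_pointsEW_iff z).1 hz).2

/-- **`ψ^*(v du) = w dx`**, exactly, in `ℂ[x, y, w]³`. -/
theorem formPullback_psi (x₀ : ℂ) :
    formPullback ψ[x₀] (![X 1, 0] : Fin 2 → MvPolynomial (Fin 2) ℂ) = wdx := by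
  funext i
  simp only [formPullback, Fin.sum_univ_two, Matrix.cons_val_zero, Matrix.cons_val_one]
  fin_cases i <;> simp [pderiv_X]

/-- Every path `γ` on `E^w_{A,B}(x₀)` (`x₀ ∈ ℚ̄`) has its image `ψ∘γ = (x∘γ − x₀, w∘γ)` on `𝔾ₘ`. -/
theorem exists_psiPath (hx₀ : IsAlgebraic ℚ x₀) (γ : CurvePath EW[A, B, x₀]) :
    ∃ δ : CurvePath 𝔾m, ∀ t, δ.toFun t = ![γ.toFun t 0 - x₀, γ.toFun t 2] :=
  (exists_imagePath (Z := EW[A, B, x₀]) (Z' := 𝔾m) ψ[x₀] (hasAlgCoeffs_psi hx₀) psi_mem γ).imp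
    fun _ h t => (h t).trans (eval_psi x₀ _)

/-- **`(E^w, w dx, γ) ∼ (𝔾ₘ, v du, ψ∘γ)`**: for every path `γ` on `E^w_{A,B}(x₀)` and `δ = ψ∘γ` on `[0, 1]`,
`(𝔾ₘ, v du, δ) − (E^w(x₀), w dx, γ) ∈ ⟨(R1)–(R5)⟩_ℚ̄` ((R4) along `ψ`, `ψ^*(v du) = w dx`; (R1)) and
`∫_δ v du = ∫_γ w dx` [cite: HuberWustholz2022, §13.1 (B) (p. 120)]. -/
theorem wdx_derivation (hE : EW[A, B, x₀].IsSmoothAffineCurve) (hx₀ : IsAlgebraic ℚ x₀)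
    {γ : CurvePath EW[A, B, x₀]} {δ : CurvePath 𝔾m}
    (hδ : ∀ t ∈ Icc (0 : ℝ) 1, δ.toFun t = ![γ.toFun t 0 - x₀, γ.toFun t 2]) :
    InSpanRel (Finsupp.single (logSym δ) (1 : ℂ) - Sy[EW[A, B, x₀], hE, wdx, hasAlgCoeffs_wdx, γ]) ∧
      (logSym δ).period = Pe[EW[A, B, x₀], hE, wdx, hasAlgCoeffs_wdx, γ] := by
  have hγ : ∀ t ∈ Icc (0 : ℝ) 1, δ.toFun t = fun j => eval (γ.toFun t) ((ψ[x₀]) j) :=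
    fun t ht => (hδ t ht).trans (eval_psi x₀ _).symm
  have h := image_of_formPullback_eq hE isSmoothAffineCurve_mulGroup _ (hasAlgCoeffs_psi hx₀) psi_mem
    _ hasAlgCoeffs_ydx _ hasAlgCoeffs_wdx isAlgebraic_one
    ((formPullback_psi x₀).trans (one_smul ℂ _).symm) hγ
  simpa only [one_smul, one_mul] using h

/-! ### The principal real logarithm along a positive real path in `𝔾ₘ` -/

/-- **`C¹` logarithm of a positive real path.**  Let `x` be `C¹` on `[0, 1]` with `x(t) = r(t) ∈ ℝ_{>0}`
there and `w·r(0) = r(1)`.  Then there is `L : ℝ → ℂ` of class `C¹` with `exp L = x` on `[0, 1]` and increment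
the REAL logarithm `L(1) − L(0) = log w` (`= log r(1) − log r(0)`: `L` and `log ∘ r` have the same derivative
`x′/x` on `[0, 1]`). [folklore] -/
theorem exists_log_realPos {x : ℝ → ℂ} (hxC : ContDiffOn ℝ 1 x (Icc 0 1)) {r : ℝ → ℝ}
    (hr : ∀ t ∈ Icc (0 : ℝ) 1, x t = (r t : ℂ)) (hpos : ∀ t ∈ Icc (0 : ℝ) 1, 0 < r t)
    {w : ℝ} (hw : w * r 0 = r 1) :
    ∃ L : ℝ → ℂ, ContDiff ℝ 1 L ∧ (∀ t ∈ Icc (0 : ℝ) 1, exp (L t) = x t) ∧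
      L 1 - L 0 = ((Real.log w : ℝ) : ℂ) := by
  have h0I : (0 : ℝ) ∈ Icc (0 : ℝ) 1 := ⟨le_rfl, zero_le_one⟩
  have h1I : (1 : ℝ) ∈ Icc (0 : ℝ) 1 := ⟨zero_le_one, le_rfl⟩
  -- `Re x = r` on `[0, 1]`; it is `C¹` there
  have hre : ∀ t ∈ Icc (0 : ℝ) 1, (x t).re = r t := fun t ht => by
    rw [hr t ht, Complex.ofReal_re]
  have hxre : ∀ t ∈ Icc (0 : ℝ) 1, x t = (((x t).re : ℝ) : ℂ) := fun t ht => by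
    rw [hre t ht]; exact hr t ht
  have hreC : ContDiffOn ℝ 1 (fun t => (x t).re) (Icc 0 1) := by
    have h := Complex.reCLM.contDiff.comp_contDiffOn hxC
    simpa [Function.comp_def] using h
  have hx0 : ∀ t ∈ Icc (0 : ℝ) 1, x t ≠ 0 := fun t ht h => by
    have h' := hpos t ht
    rw [← hre t ht, h, Complex.zero_re] at h'
    exact lt_irrefl _ h'
  obtain ⟨L, hLC, -, hLd, hLexp⟩ := exists_contDiff_exp_eq zero_lt_one hxC hx0
  -- derivatives within `[0, 1]`
  have hred : ∀ t ∈ Icc (0 : ℝ) 1, HasDerivWithinAt (fun s => (x s).re)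
      (derivWithin (fun s => (x s).re) (Icc 0 1) t) (Icc 0 1) t :=
    fun t ht => ((hreC.differentiableOn one_ne_zero) t ht).hasDerivWithinAt
  have hdx : ∀ t ∈ Icc (0 : ℝ) 1, derivWithin x (Icc 0 1) t =
      ((derivWithin (fun s => (x s).re) (Icc 0 1) t : ℝ) : ℂ) := by
    intro t ht
    have h1 : derivWithin x (Icc 0 1) t =
        derivWithin (fun s => (((x s).re : ℝ) : ℂ)) (Icc 0 1) t :=
      derivWithin_congr (fun s hs => hxre s hs) (hxre t ht)
    rw [h1]
    exact (hred t ht).ofReal_comp.derivWithin (uniqueDiffOn_Icc zero_lt_one t ht)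
  have hne : ∀ t ∈ Icc (0 : ℝ) 1, (x t).re ≠ 0 := fun t ht => by
    rw [hre t ht]; exact (hpos t ht).ne'
  -- the real logarithm `F = log ∘ Re x` has the same derivative as `L` on `[0, 1]`
  have hFd : ∀ t ∈ Icc (0 : ℝ) 1, HasDerivWithinAt (fun s => ((Real.log ((x s).re) : ℝ) : ℂ))
      ((derivWithin (fun s => (x s).re) (Icc 0 1) t / (x t).re : ℝ) : ℂ) (Icc 0 1) t :=
    fun t ht => ((hred t ht).log (hne t ht)).ofReal_comp
  have hLd' : ∀ t ∈ Icc (0 : ℝ) 1, HasDerivWithinAt L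
      ((derivWithin (fun s => (x s).re) (Icc 0 1) t / (x t).re : ℝ) : ℂ) (Icc 0 1) t := by
    intro t ht
    have h := (hLd t ht).hasDerivWithinAt (s := Icc 0 1)
    have e : derivWithin x (Icc 0 1) t / x t =
        ((derivWithin (fun s => (x s).re) (Icc 0 1) t / (x t).re : ℝ) : ℂ) := by
      rw [hdx t ht, Complex.ofReal_div]
      congr 1
      exact hxre t ht
    rwa [e] at h
  -- `L − F` is constant on `[0, 1]`
  have hD : ∀ t ∈ Icc (0 : ℝ) 1,
      HasDerivWithinAt (fun s => L s - ((Real.log ((x s).re) : ℝ) : ℂ)) 0 (Icc 0 1) t := by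
    intro t ht
    have h := (hLd' t ht).sub (hFd t ht)
    rwa [sub_self] at h
  have hconst := constant_of_derivWithin_zero
    (fun t ht => (hD t ht).differentiableWithinAt)
    (fun t ht => (hD t (Ico_subset_Icc_self ht)).derivWithin
      (uniqueDiffOn_Icc zero_lt_one t (Ico_subset_Icc_self ht)))
  have h1 : L 1 - ((Real.log ((x 1).re) : ℝ) : ℂ) = L 0 - ((Real.log ((x 0).re) : ℝ) : ℂ) :=
    hconst 1 h1I
  refine ⟨L, hLC, hLexp, ?_⟩
  rw [hre 1 h1I, hre 0 h0I] at h1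
  rw [eq_div_of_mul_eq (hpos 0 h0I).ne' hw, Real.log_div (hpos 1 h1I).ne' (hpos 0 h0I).ne']
  push_cast
  linear_combination h1

/-- **A positive real path on `𝔾ₘ` is a real logarithm symbol.**  If the first coordinate of `γ` is real and
positive on `[0, 1]`, from `r(0)` to `r(1) = w·r(0)`, then `(𝔾ₘ, v du, γ) ∼ ℓ(log w)` with the real logarithm
`log w`, modulo the `ℚ̄`-span of (R1)–(R5) ((R5) to the exponential path with the same logarithm, then the (R4)
base change `u ↦ u/r(0)`) [cite: HuberWustholz2022, §3.3.1 (pp. 42–43), §13.1 (B) (p. 120)]. -/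
theorem span_realPos_logSym (γ : CurvePath 𝔾m) {r : ℝ → ℝ}
    (hr : ∀ t ∈ Icc (0 : ℝ) 1, γ.toFun t 0 = (r t : ℂ)) (hpos : ∀ t ∈ Icc (0 : ℝ) 1, 0 < r t)
    {w : ℝ} (hw : w * r 0 = r 1) (E : CurvePath 𝔾m)
    (hE : ∀ t, E.toFun t = ![exp ((1 - t) * 0 + t * ((Real.log w : ℝ) : ℂ)),
      exp (-((1 - t) * 0 + t * ((Real.log w : ℝ) : ℂ)))]) :
    InSpanRel (Finsupp.single (logSym γ) (1 : ℂ) - Finsupp.single (logSym E) 1) := by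
  obtain ⟨L, hLC, hLexp, hL1⟩ :=
    exists_log_realPos (x := fun t => γ.toFun t 0) (contDiffOn_pi.1 γ.contDiffOn 0) hr hpos hw
  obtain ⟨E₁, ρ₁, ρ₂, ρ₃, ρ₄, hE₁, h₁, h₂, h₃, h₄, he⟩ :=
    single_path_eq_single_expPath ![X 1, 0] hasAlgCoeffs_ydx γ L hLC hLexp
  have halg : IsAlgebraic ℚ (exp (L 0)) := by
    rw [hLexp 0 ⟨le_rfl, zero_le_one⟩]
    exact γ.algebraic_zero 0
  have hE' : ∀ t, E.toFun t =
      ![exp ((1 - t) * 0 + t * (L 1 - L 0)), exp (-((1 - t) * 0 + t * (L 1 - L 0)))] := by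
    intro t; rw [hE, hL1]
  have hbc := rel_expPath_baseChange halg E₁ E hE₁ hE'
  obtain ⟨k, ρ, a, hρ, ha, hsum⟩ := span_add (span_add (span_sub (span_add (span_of_rel h₃)
    (span_of_rel h₄)) (span_of_rel h₁)) (span_smul isAlgebraic_one.neg (span_of_rel h₂)))
    (span_of_rel hbc)
  refine ⟨k, ρ, a, hρ, ha, ?_⟩
  rw [← hsum, he]
  simp only [neg_one_smul]
  abel

/-- **The real logarithm path exists**: for `w ∈ ℚ̄ ∩ ℝ_{>0}` the exponential path `E_{0, log w}` of the
symbol `ℓ(log w)` is a `C¹` path on `𝔾ₘ` with algebraic end points `(1, 1)`, `(w, 1/w)`. -/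
theorem exists_realLogPath {w : ℝ} (hw : 0 < w) (hwa : IsAlgebraic ℚ (w : ℂ)) :
    ∃ E : CurvePath 𝔾m, ∀ t, E.toFun t = ![exp ((1 - t) * 0 + t * ((Real.log w : ℝ) : ℂ)),
      exp (-((1 - t) * 0 + t * ((Real.log w : ℝ) : ℂ)))] := by
  refine exists_expPath (by rw [exp_zero]; exact isAlgebraic_one) ?_
  rw [← Complex.ofReal_exp, Real.exp_log hw]
  exact hwa

/-- **The period of `ℓ(log w)` is `log w`** [cite: HuberWustholz2022, §10.1 (p. 96)]. -/
theorem period_realLogPath {w : ℝ} (E : CurvePath 𝔾m)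
    (hE : ∀ t, E.toFun t = ![exp ((1 - t) * 0 + t * ((Real.log w : ℝ) : ℂ)),
      exp (-((1 - t) * 0 + t * ((Real.log w : ℝ) : ℂ)))]) :
    (logSym E).period = ((Real.log w : ℝ) : ℂ) := by
  rw [period_ydx_expPath 0 _ E hE, sub_zero]

end Summit.KontsevichZagierPeriods.KzOnePeriods.XiDerivation

end
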